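import Summits.QuantumFields.YangMills.Theorems.ColdStartUniversalityLatticeLangevinWilsonSpectralGap
import HarnessLib

/-!
# Route `ColdStartUniversality` (fixed-cut-off `L²(μ_{β'})` package): the POINCARÉ INEQUALITY for the Wilson measure
# `μ_{β'}` on `SU(2)^E` at every coupling — `c · Var_μ(F) ≤ 𝓔(F)` with the Doeblin rate `c`

Helper file (seat `ym-line-csu-p1`, g16), sequel of `…WilsonSpectralGap` (`wilson_spectralGap`: for centred continuous `F`,
`⟨F, P_t F⟩_μ ≤ e^{-ct} ‖F‖²_μ` with `c = c(L, β') > 0` the Doeblin rate of `exp_mixing_szz`).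

* `fderiv_eq_of_eqOn_ball`, `fderiv_fderiv_eq_of_eqOn_ball` — localisation: if `g = f + a` on an open ball, the first and
  second derivatives of `g` and `f` agree there (a bump function `≡ 1` near the group does not change `𝓛f` ON the group).
* ★★ `wilson_poincare` — for every `C³` function `f` of the real link coordinates, `F = f∘coords`, `m = μ(F)`:
  GENERATOR FORM `c · ∫ (F − m)² dμ_{β'} ≤ −∫ (F − m) · 𝓛f dμ_{β'}` and GRADIENT (carré du champ) FORM
  `c · ∫ (F − m)² dμ_{β'} ≤ ½ ∫ Γ(f,f) dμ_{β'}`, `Γ(f,f) = Σ_{ij} ∂_i f ∂_j f (σσᵀ)_{ij}` (the tree's energy identity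
  `two_mul_integral_mul_generator_eq_neg_carre`), with the SAME `c` as the spectral gap (restated as the first conjunct).
  Proof: `F − m = g∘coords` with `g = χ·(f − m)` compactly supported (`χ` a `ContDiffBump` `≡ 1` on the ball of radius
  `2 ⊇ coords(SU(2)^E)`), `𝓛g = 𝓛f` and `Γ(g,g) = Γ(f,f)` on the group, and the gap is differentiated at `t = 0⁺` by the
  tree's `tendsto_dirichletForm_semigroup` (`τ⁻¹(⟨G,P_τG⟩ − ‖G‖²) → ⟨G, 𝓛g⟩_μ`) against `τ⁻¹(e^{-cτ} − 1)‖G‖² → −c‖G‖²`.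

Reading: the Poincaré constant of `μ_{β'}` (w.r.t. the SZZ Dirichlet form) is at most `1/c(L,β')`; equivalently the
variational spectral gap `λ_K = inf 𝓔/Var ≥ c_K` at each fixed cut-off — the quantity whose K-UNIFORM control in physical
units the crux asks for and this file does NOT provide.  THEOREMS ONLY, no definition, no sorry, standard axioms.
HONEST FRAMING: fixed-cut-off plumbing; no rung, crux or summit statement is proved; the Yang–Mills mass gap is NOT proved.
-/

set_option autoImplicit false

noncomputable section

namespace Summit.QuantumFields.YangMills.Theorems.ColdStartUniversality

open MeasureTheory ProbabilityTheory Finset Filter Set Topology Metric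
open scoped BigOperators NNReal ENNReal
open Literature.Probability.Process Literature.MathematicalPhysics.QuantumFieldTheory
open Literature.MathematicalPhysics.QuantumLattice (fundamentalRep fundamentalLatticeRep continuous_fundamentalRep)

variable {L : ℕ} [NeZero L]

/-! ## Localisation of derivatives (a bump function `≡ 1` near the group does not change `𝓛f` on the group) -/

/-- If `g = f + a` on an open ball then `fderiv g = fderiv f` on that ball. [folklore] -/
theorem fderiv_eq_of_eqOn_ball {E : Type*} [NormedAddCommGroup E] [NormedSpace ℝ E] {f g : E → ℝ} {a r : ℝ} {x : E}
    (h : ∀ y ∈ ball (0 : E) r, g y = f y + a) (hx : x ∈ ball (0 : E) r) : fderiv ℝ g x = fderiv ℝ f x := by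
  have hev : g =ᶠ[𝓝 x] fun y => f y + a :=
    Filter.eventuallyEq_of_mem (isOpen_ball.mem_nhds hx) fun y hy => h y hy
  rw [hev.fderiv_eq, fderiv_add_const]

/-- If `g = f + a` on an open ball then the second directional derivatives of `g` and `f` agree on that ball. [folklore] -/
theorem fderiv_fderiv_eq_of_eqOn_ball {E : Type*} [NormedAddCommGroup E] [NormedSpace ℝ E] {f g : E → ℝ} {a r : ℝ}
    {x : E} (h : ∀ y ∈ ball (0 : E) r, g y = f y + a) (hx : x ∈ ball (0 : E) r) (v : E) :
    fderiv ℝ (fun z => fderiv ℝ g z v) x = fderiv ℝ (fun z => fderiv ℝ f z v) x := by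
  have hev : (fun z => fderiv ℝ g z v) =ᶠ[𝓝 x] fun z => fderiv ℝ f z v :=
    Filter.eventuallyEq_of_mem (isOpen_ball.mem_nhds hx) fun z hz => by
      show fderiv ℝ g z v = fderiv ℝ f z v
      rw [fderiv_eq_of_eqOn_ball h hz]
  exact hev.fderiv_eq

/-! ## The Poincaré inequality for the Wilson measure -/

/-- ★★ **Poincaré inequality for the Wilson measure `μ_{β'}` on `SU(2)^E`, every `β'`, every `L`.**  There is `c > 0`
(the Doeblin rate of `exp_mixing_szz`, the same constant as in `wilson_spectralGap`, restated as the first conjunct) such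
that for every `C³` function `f` of the real link coordinates, with `F = f∘coords`, `m = ∫ F dμ_{β'}` and `𝓛f` the SZZ
generator in coordinates,
`c · ∫ (F − m)² dμ_{β'} ≤ −∫ (F − m) · 𝓛f dμ_{β'} = 𝓔(F)` (generator form) and `c · ∫ (F − m)² dμ_{β'} ≤ ½ ∫ Γ(f,f) dμ_{β'}`
(gradient form, `Γ(f,f) = Σ_{ij} ∂_i f ∂_j f (σσᵀ)_{ij}`, by `two_mul_integral_mul_generator_eq_neg_carre` for `g`).  Proof: `F − m = g∘coords` for the compactly supported
`g = χ · (f − m)` (`χ` a bump `≡ 1` on the ball of radius `2 ⊇ coords(SU(2)^E)`), `𝓛g = 𝓛f` on the group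
(`fderiv_eq_of_eqOn_ball`, `fderiv_fderiv_eq_of_eqOn_ball`); the gap `⟨G, P_τ G⟩ ≤ e^{-cτ}‖G‖²` is differentiated at
`τ = 0⁺` with `tendsto_dirichletForm_semigroup`: `⟨G, 𝓛g⟩_μ ≤ −c ‖G‖²_μ`.
[cite: ShenZhuZhu2022, §3 (Dirichlet form 𝓔^L(F,G) = -∫ 𝓛F G dμ, p. 13)] [cite: RobertsRosenthal1997, Theorem 2.1] -/
theorem wilson_poincare (L : ℕ) [NeZero L] (β' : ℝ) :
    ∃ c : ℝ, 0 < c ∧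
      (∀ (κ : ℝ≥0 → Kernel (GaugeConfig 3 L (Matrix.specialUnitaryGroup (Fin 2) ℂ))
          (GaugeConfig 3 L (Matrix.specialUnitaryGroup (Fin 2) ℂ))) [∀ t, IsMarkovKernel (κ t)],
        (∀ (t : ℝ≥0) (x : GaugeConfig 3 L (Matrix.specialUnitaryGroup (Fin 2) ℂ))
          (Ω : Type) [MeasurableSpace Ω] (P : Measure Ω) [IsProbabilityMeasure P]
          (W : ℝ≥0 → Ω → (Edge 3 L × NoiseIdx 2 → ℝ)) (hW : IsFlatBrownian W P)
          (U : ℝ≥0 → Ω → GaugeConfig 3 L (Matrix.specialUnitaryGroup (Fin 2) ℂ)),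
          (∀ ω, U 0 ω = x) →
          (latticeLangevinDynamics (fundamentalLatticeRep 2) β').IsSolution (fundamentalRep (Fin 2))
            hW.natFiltration P W U →
          κ t x = P.map (U t)) →
        ∀ (F : GaugeConfig 3 L (Matrix.specialUnitaryGroup (Fin 2) ℂ) → ℝ), Continuous F →
          ∫ x, F x ∂(wilsonMeasure (d := 3) (L := L) (fundamentalRep (Fin 2)) β') = 0 → ∀ t : ℝ≥0,
            ∫ x, F x * (∫ y, F y ∂(κ t x)) ∂(wilsonMeasure (d := 3) (L := L) (fundamentalRep (Fin 2)) β') ≤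
              Real.exp (-c * t) * ∫ x, F x * F x ∂(wilsonMeasure (d := 3) (L := L) (fundamentalRep (Fin 2)) β')) ∧
      ∀ (f : (Edge 3 L × Fin 2 × Fin 2 × Bool → ℝ) → ℝ), ContDiff ℝ 3 f →
        let coords : GaugeConfig 3 L (Matrix.specialUnitaryGroup (Fin 2) ℂ) → (Edge 3 L × Fin 2 × Fin 2 × Bool → ℝ) :=
          fun V q => (fun z : ℂ => if q.2.2.2 then z.im else z.re)
            ((fundamentalRep (Fin 2) (V q.1) : Matrix (Fin 2) (Fin 2) ℂ) q.2.1 q.2.2.1)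
        let A : GaugeConfig 3 L (Matrix.specialUnitaryGroup (Fin 2) ℂ) → (Edge 3 L × Fin 2 × Fin 2 × Bool) →
            (Edge 3 L × Fin 2 × Fin 2 × Bool) → ℝ := fun V i j =>
          ∑ n : Edge 3 L × NoiseIdx 2,
            (if n.1 = i.1 then (fun z : ℂ => if i.2.2.2 then z.im else z.re)
              ((latticeLangevinDynamics (fundamentalLatticeRep 2) β').noise
                (matrixConfig (fundamentalRep (Fin 2)) V) i.1 n.2 i.2.1 i.2.2.1) else 0) *
            (if n.1 = j.1 then (fun z : ℂ => if j.2.2.2 then z.im else z.re)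
              ((latticeLangevinDynamics (fundamentalLatticeRep 2) β').noise
                (matrixConfig (fundamentalRep (Fin 2)) V) j.1 n.2 j.2.1 j.2.2.1) else 0)
        let gen : GaugeConfig 3 L (Matrix.specialUnitaryGroup (Fin 2) ℂ) → ℝ := fun V =>
          (∑ i : Edge 3 L × Fin 2 × Fin 2 × Bool, fderiv ℝ f (coords V) (Pi.single i 1) *
              (fun z : ℂ => if i.2.2.2 then z.im else z.re)
                ((latticeLangevinDynamics (fundamentalLatticeRep 2) β').drift
                  (matrixConfig (fundamentalRep (Fin 2)) V) i.1 i.2.1 i.2.2.1) +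
          1 / 2 * ∑ i : Edge 3 L × Fin 2 × Fin 2 × Bool, ∑ j : Edge 3 L × Fin 2 × Fin 2 × Bool,
            fderiv ℝ (fun z => fderiv ℝ f z (Pi.single i 1)) (coords V) (Pi.single j 1) * A V i j)
        (c * ∫ V, (f (coords V) - ∫ V', f (coords V') ∂(wilsonMeasure (d := 3) (L := L) (fundamentalRep (Fin 2)) β')) ^ 2
            ∂(wilsonMeasure (d := 3) (L := L) (fundamentalRep (Fin 2)) β') ≤
          -∫ V, (f (coords V) - ∫ V', f (coords V') ∂(wilsonMeasure (d := 3) (L := L) (fundamentalRep (Fin 2)) β')) *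
            gen V ∂(wilsonMeasure (d := 3) (L := L) (fundamentalRep (Fin 2)) β')) ∧
        (c * ∫ V, (f (coords V) - ∫ V', f (coords V') ∂(wilsonMeasure (d := 3) (L := L) (fundamentalRep (Fin 2)) β')) ^ 2
            ∂(wilsonMeasure (d := 3) (L := L) (fundamentalRep (Fin 2)) β') ≤
          1 / 2 * ∫ V, (∑ i : Edge 3 L × Fin 2 × Fin 2 × Bool, ∑ j : Edge 3 L × Fin 2 × Fin 2 × Bool,
            fderiv ℝ f (coords V) (Pi.single i 1) * fderiv ℝ f (coords V) (Pi.single j 1) * A V i j)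
            ∂(wilsonMeasure (d := 3) (L := L) (fundamentalRep (Fin 2)) β')) := by
  classical
  haveI := secondCountableTopology_su2
  haveI := borelSpace_config L
  haveI : IsProbabilityMeasure (wilsonMeasure (d := 3) (L := L) (fundamentalRep (Fin 2)) β') :=
    isProbabilityMeasure_wilsonMeasure (d := 3) (L := L) (fundamentalRep (Fin 2)) (continuous_fundamentalRep (Fin 2)) β'
  obtain ⟨c, hc, hgap⟩ := wilson_spectralGap L β'
  refine ⟨c, hc, fun κ _ hreal F hF hF0 t => (hgap κ hreal F hF t).1 hF0, fun f hf => ?_⟩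
  intro coords A gen
  set μ : Measure (GaugeConfig 3 L (Matrix.specialUnitaryGroup (Fin 2) ℂ)) :=
    wilsonMeasure (d := 3) (L := L) (fundamentalRep (Fin 2)) β' with hμ
  -- THE transition kernels
  obtain ⟨κ, hκ, -, hreal⟩ := exists_transitionKernel L β'
  haveI := hκ
  -- the centred observable as a compactly supported cylinder function: `g = χ · (f − m)`
  set m : ℝ := ∫ V', f (coords V') ∂μ with hm
  let χ : ContDiffBump (0 : (Edge 3 L × Fin 2 × Fin 2 × Bool) → ℝ) := ⟨2, 3, by norm_num, by norm_num⟩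
  set g : ((Edge 3 L × Fin 2 × Fin 2 × Bool) → ℝ) → ℝ := fun y =>
    (χ : ((Edge 3 L × Fin 2 × Fin 2 × Bool) → ℝ) → ℝ) y * (f y - m) with hgdef
  have hg : ContDiff ℝ 3 g := χ.contDiff.mul (hf.sub contDiff_const)
  have hgc : HasCompactSupport g := χ.hasCompactSupport.mul_right
  have hball : ∀ V : GaugeConfig 3 L (Matrix.specialUnitaryGroup (Fin 2) ℂ),
      coords V ∈ ball (0 : (Edge 3 L × Fin 2 × Fin 2 × Bool) → ℝ) 2 := by
    intro V
    rw [mem_ball, dist_zero_right]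
    exact (norm_coords_le_one V).trans_lt (by norm_num)
  have hEq : ∀ y ∈ ball (0 : (Edge 3 L × Fin 2 × Fin 2 × Bool) → ℝ) 2, g y = f y + (-m) := by
    intro y hy
    have h1 : (χ : ((Edge 3 L × Fin 2 × Fin 2 × Bool) → ℝ) → ℝ) y = 1 :=
      χ.one_of_mem_closedBall (ball_subset_closedBall hy)
    simp only [hgdef, h1, one_mul, sub_eq_add_neg]
  have hgF : ∀ V, g (coords V) = f (coords V) - m := fun V => by rw [hEq _ (hball V), ← sub_eq_add_neg]
  -- `𝓛g = 𝓛f` on the group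
  set geng : GaugeConfig 3 L (Matrix.specialUnitaryGroup (Fin 2) ℂ) → ℝ := fun V =>
    (∑ i : Edge 3 L × Fin 2 × Fin 2 × Bool, fderiv ℝ g (coords V) (Pi.single i 1) *
        (fun z : ℂ => if i.2.2.2 then z.im else z.re)
          ((latticeLangevinDynamics (fundamentalLatticeRep 2) β').drift
            (matrixConfig (fundamentalRep (Fin 2)) V) i.1 i.2.1 i.2.2.1) +
    1 / 2 * ∑ i : Edge 3 L × Fin 2 × Fin 2 × Bool, ∑ j : Edge 3 L × Fin 2 × Fin 2 × Bool,
      fderiv ℝ (fun z => fderiv ℝ g z (Pi.single i 1)) (coords V) (Pi.single j 1) * A V i j) with hgengdef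
  have hfd : ∀ V, fderiv ℝ g (coords V) = fderiv ℝ f (coords V) := fun V => fderiv_eq_of_eqOn_ball hEq (hball V)
  have hgen : ∀ V, geng V = gen V := by
    intro V
    simp only [hgengdef, gen, fderiv_eq_of_eqOn_ball hEq (hball V), fderiv_fderiv_eq_of_eqOn_ball hEq (hball V)]
  -- the objects of the limit
  set G : GaugeConfig 3 L (Matrix.specialUnitaryGroup (Fin 2) ℂ) → ℝ := fun V => g (coords V) with hGdef
  have hGc : Continuous G := hg.continuous.comp (continuous_coords (L := L))
  set φ₀ : ℝ := ∫ V, G V * G V ∂μ with hφ₀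
  set d : ℝ := ∫ V, G V * geng V ∂μ with hd
  have hG0 : ∫ V, G V ∂μ = 0 := by
    have hFi : Integrable (fun V => f (coords V)) μ :=
      integrable_of_continuous_of_compactSpace (hf.continuous.comp (continuous_coords (L := L))) μ
    simp_rw [hGdef, hgF]
    rw [integral_sub hFi (integrable_const m)]
    simp [hm]
  -- the Dirichlet form of the semigroup on `g`
  have hs : Tendsto (fun τ : ℝ => τ⁻¹ * ((∫ V, G V * (∫ y, G y ∂(κ τ.toNNReal V)) ∂μ) - φ₀)) (𝓝[>] 0) (𝓝 d) :=
    tendsto_dirichletForm_semigroup L β' κ hreal hg hgc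
  -- the gap along `τ ↓ 0`: `τ⁻¹ (⟨G, P_τ G⟩ − ‖G‖²) ≤ τ⁻¹ (e^{-cτ} − 1) ‖G‖² → −c ‖G‖²`
  have hexp : Tendsto (fun τ : ℝ => τ⁻¹ * ((Real.exp (-c * τ) - 1) * φ₀)) (𝓝[>] 0) (𝓝 (-c * φ₀)) := by
    have hD : HasDerivAt (fun τ : ℝ => Real.exp (-c * τ) * φ₀) (-c * φ₀) 0 := by
      have h1 : HasDerivAt (fun τ : ℝ => -c * τ) (-c) 0 := by
        simpa using (hasDerivAt_id (0 : ℝ)).const_mul (-c)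
      have h2 := (h1.exp).mul_const φ₀
      simpa using h2
    have h := hD.tendsto_slope_zero_right
    refine h.congr' (Eventually.of_forall fun τ => ?_)
    simp only [zero_add, mul_zero, Real.exp_zero, one_mul, smul_eq_mul]
    ring
  have hle : ∀ᶠ τ in 𝓝[>] (0 : ℝ),
      τ⁻¹ * ((∫ V, G V * (∫ y, G y ∂(κ τ.toNNReal V)) ∂μ) - φ₀) ≤ τ⁻¹ * ((Real.exp (-c * τ) - 1) * φ₀) := by
    filter_upwards [self_mem_nhdsWithin] with τ hτ
    have hτ' : (0 : ℝ) < τ := hτ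
    have h := (hgap κ hreal G hGc τ.toNNReal).1 hG0
    rw [Real.coe_toNNReal _ hτ'.le] at h
    refine mul_le_mul_of_nonneg_left ?_ (inv_nonneg.2 hτ'.le)
    linarith [h]
  have hdle : d ≤ -c * φ₀ := le_of_tendsto_of_tendsto hs hexp hle
  -- the energy identity for `g`: `2 ⟨G, 𝓛g⟩ = -∫ Γ(g,g) = -∫ Γ(f,f)`
  have hcarre : 2 * ∫ V, G V * geng V ∂μ =
      -∫ V, (∑ i : Edge 3 L × Fin 2 × Fin 2 × Bool, ∑ j : Edge 3 L × Fin 2 × Fin 2 × Bool,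
        fderiv ℝ g (coords V) (Pi.single i 1) * fderiv ℝ g (coords V) (Pi.single j 1) * A V i j) ∂μ :=
    two_mul_integral_mul_generator_eq_neg_carre L β' hg hgc
  simp only [hfd] at hcarre
  -- read back on `f`
  have hφ₀' : φ₀ = ∫ V, (f (coords V) - m) ^ 2 ∂μ := by
    simp only [hφ₀, hGdef, hgF, sq]
  have hd' : d = ∫ V, (f (coords V) - m) * gen V ∂μ := by
    simp only [hd, hGdef, hgF, hgen]
  refine ⟨?_, ?_⟩
  · rw [← hφ₀', ← hd']
    linarith
  · rw [← hφ₀']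
    linarith

end Summit.QuantumFields.YangMills.Theorems.ColdStartUniversality

end
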